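import Summits.NavierStokesRegularity.NavierStokesRegularity.Theorems.RungBlowupCofinal.SectoralWaveAnsatz
import Summits.NavierStokesRegularity.NavierStokesRegularity.Theorems.RungBlowupCofinal.ToroidalLift
import HarnessLib

/-!
# The REYNOLDS STRESS of the sectoral toroidal wave in closed form — the first NONLINEAR letter
# of the mean–wave radial system (route `AngularGalerkinLadder`, crux K1 `RungBlowupCofinal`;
# kinematic helper, theorems only)

Cell `ns-blowup`, seat `ns-blowup-circuit` (g12, AGL Lean seat). Helper file for
`stmt-NavierStokesRegularity-19959` serving `Cruxes/RungBlowupCofinal/Lines/qlwave.lean`, card support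
target **(S5)** («the convective letters … `meanStress n W` on products of lifts»), for the (S1)
witness class: the SECTORAL TOROIDAL WAVE `W = c(‖y‖²) y × ∇Re ℓⁿ`, `ℓ(y) = y₀ + iy₁` (g11
`exists_sectoral_toroidal_wave`), with quadrature companion `W' = n⁻¹J₃W = c(‖y‖²) y × ∇Im ℓⁿ`
(`angGen_two_toroidalSectoral`). For `n = m + 2 ≥ 2` (`toroidalSectoral_selfAdvection_sum`):

  `(W·∇)W + (W'·∇)W' = c(‖y‖²)²·n²·[(2(n−1)y₂²s^{n−2} − s^{n−1})(y₀, y₁, 0) − 2n y₂ s^{n−1} e₃]`,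
  `s = y₀² + y₁²`;

hence `meanStress n W = ½(…)` (`meanStress_toroidalSectoral`, in the line's letters) is ZONAL and
purely POLOIDAL/meridional (no `e_φ` component): a pure toroidal wave forces ROLLS, not STREAKS —
the swirl must come from the zonal dynamics (lift-up), the SSP ordering of the card's ## Transfer —
and it is an explicit polynomial × radial field of degree `2n − 1`: the forcing letter of the
zonal equation of the sectoral `(L, L)` cell of the radial boundary-value problem (card §2).
Intermediate letters: `gradient_re_pow_eq` / `gradient_im_pow_eq` (`∇Re ℓⁿ = n(Re ℓ^{n−1},
−Im ℓ^{n−1}, 0)`, `∇Im ℓⁿ = n(Im ℓ^{n−1}, Re ℓ^{n−1}, 0)`), their Hessians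
(`fderiv_gradient_re_pow_eq`, `fderiv_gradient_im_pow_eq`), and the product rules
`convect_toroidalLift` (advection of a radially modulated toroidal lift by ANY field),
`convect_toroidal_self` (the radial derivative drops out, `⟪y, y × ·⟫ = 0`).

LABEL: KERNEL kinematics. Nothing here asserts a Theses declaration; no definition, no named fact,
no sorry. WHAT THIS IS NOT: not Navier–Stokes evidence and not a profile — the zonal RESPONSE to
this forcing (the other half of the SSP loop) is the radial BVP, untouched.
References: [cite: BullardGellman1954]; [cite: MajdaBertozziCUP2002, §1.1 (vector identities)]. -/

noncomputable section

namespace Summit.NavierStokesRegularity.AngularGalerkinLadderSectoralReynoldsStress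

open Set Function Complex
open scoped ContDiff RealInnerProductSpace
open Literature.Analysis.FluidPDE
open Summit.NavierStokesRegularity.FluidComputer Summit.NavierStokesRegularity.FluidComputer.AngularLadder
open Summit.NavierStokesRegularity.AngularGalerkinLadderSectoralHarmonics
open Summit.NavierStokesRegularity.AngularGalerkinLadderSectoralWaveAnsatz Summit.NavierStokesRegularity.AngularGalerkinLadderToroidalLift

variable (ℓ : EuclideanSpace ℝ (Fin 3) →L[ℝ] ℂ)

/-! ## §1 Product rules for radially modulated toroidal lifts -/

/-- The derivative of a radial profile: `D(c(‖·‖²))(y) w = c′(‖y‖²) · 2⟪y, w⟫`. [folklore] -/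
private theorem fderiv_radial_apply' {c : ℝ → ℝ} (hc : Differentiable ℝ c)
    (y w : EuclideanSpace ℝ (Fin 3)) :
    fderiv ℝ (fun x : EuclideanSpace ℝ (Fin 3) => c (‖x‖ ^ 2)) y w =
      deriv c (‖y‖ ^ 2) * (2 * ⟪y, w⟫) := by
  have h : HasFDerivAt (fun x : EuclideanSpace ℝ (Fin 3) => c (‖x‖ ^ 2))
      (deriv c (‖y‖ ^ 2) • (2 : ℕ) • innerSL ℝ y) y :=
    ((hc (‖y‖ ^ 2)).hasDerivAt).comp_hasFDerivAt y (hasStrictFDerivAt_norm_sq y).hasFDerivAt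
  rw [h.fderiv]
  simp

/-- `⟪y, y × v⟫ = 0`. [folklore] -/
private theorem inner_self_cross' (y v : EuclideanSpace ℝ (Fin 3)) : ⟪y, cross y v⟫ = 0 := by
  simp only [cross, PiLp.inner_apply, cross_apply, RCLike.inner_apply, conj_trivial,
    Fin.sum_univ_three, Matrix.cons_val_zero, Matrix.cons_val_one, Matrix.cons_val_two,
    Matrix.head_cons, Matrix.tail_cons]
  ring

/-- `(c • v) × w = c • (v × w)`. [folklore] -/
private theorem cross_smul_left' (c : ℝ) (v w : EuclideanSpace ℝ (Fin 3)) :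
    cross (c • v) w = c • cross v w := by
  apply PiLp.ext; intro i; fin_cases i <;> simp [cross, cross_apply]
/-- `v × (c • w) = c • (v × w)`. [folklore] -/
private theorem cross_smul_right' (c : ℝ) (v w : EuclideanSpace ℝ (Fin 3)) :
    cross v (c • w) = c • cross v w := by
  apply PiLp.ext; intro i; fin_cases i <;> simp [cross, cross_apply]
/-- A coordinate of a vector is its pairing with the basis vector. [folklore] -/
private theorem apply_eq_inner_single (v : EuclideanSpace ℝ (Fin 3)) (i : Fin 3) :
    v i = ⟪v, EuclideanSpace.single i (1 : ℝ)⟫ := by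
  rw [EuclideanSpace.inner_single_right]; simp

/-- `⟪D(∇f)(y) v, w⟫ = D(z ↦ Df(z) w)(y) v` for `C²` scalar `f`. [folklore] -/
private theorem inner_fderiv_gradient {f : EuclideanSpace ℝ (Fin 3) → ℝ} (hf : ContDiff ℝ 2 f)
    (y v w : EuclideanSpace ℝ (Fin 3)) :
    ⟪fderiv ℝ (gradient f) y v, w⟫ = fderiv ℝ (fun z => fderiv ℝ f z w) y v := by
  have hgd : DifferentiableAt ℝ (gradient f) y := by
    have hc : ContDiff ℝ 1 (gradient f) := by
      have e : gradient f = fun z =>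
          (InnerProductSpace.toDual ℝ (EuclideanSpace ℝ (Fin 3))).symm (fderiv ℝ f z) := rfl
      rw [e]
      exact (InnerProductSpace.toDual ℝ (EuclideanSpace ℝ (Fin 3))).symm.contDiff.comp
        (hf.fderiv_right (m := 1) (by norm_num))
    exact (hc.differentiable one_ne_zero) y
  have e : (fun z => fderiv ℝ f z w) = fun z => ⟪gradient f z, w⟫ :=
    funext fun z => (inner_gradient_left (f := f) (x := z) (y := w)).symm
  rw [e, fderiv_inner_apply ℝ hgd (differentiableAt_const w)]
  simp

/-- The gradient field of a smooth function is differentiable. [folklore] -/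
private theorem differentiable_gradient_of_smooth {f : EuclideanSpace ℝ (Fin 3) → ℝ}
    (hf : ContDiff ℝ ∞ f) : Differentiable ℝ (gradient f) := by
  have e : gradient f = fun z =>
      (InnerProductSpace.toDual ℝ (EuclideanSpace ℝ (Fin 3))).symm (fderiv ℝ f z) := rfl
  rw [e]
  exact ((InnerProductSpace.toDual ℝ (EuclideanSpace ℝ (Fin 3))).symm.contDiff.comp
    ((contDiff_infty_iff_fderiv.1 hf).2)).differentiable (by simp)

/-- Coordinates of the cross product. [folklore] -/
private theorem cross_apply_zero' (a b : EuclideanSpace ℝ (Fin 3)) :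
    cross a b 0 = a 1 * b 2 - a 2 * b 1 := by simp [cross, cross_apply]
/-- Coordinates of the cross product. [folklore] -/
private theorem cross_apply_one' (a b : EuclideanSpace ℝ (Fin 3)) :
    cross a b 1 = a 2 * b 0 - a 0 * b 2 := by simp [cross, cross_apply]
/-- Coordinates of the cross product. [folklore] -/
private theorem cross_apply_two' (a b : EuclideanSpace ℝ (Fin 3)) :
    cross a b 2 = a 0 * b 1 - a 1 * b 0 := by simp [cross, cross_apply]

/-- **Advection of a radially modulated toroidal lift by any field**: for differentiable `c`, a
`C¹` field `G` and any `u`,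
`(u·∇)(c(‖·‖²) · (· × G))(y) = c(‖y‖²)·(u(y) × G(y) + y × DG(y)u(y)) + 2c′(‖y‖²)⟪y, u(y)⟫ · y × G(y)`.
[folklore] -/
theorem convect_toroidalLift {c : ℝ → ℝ} (hc : Differentiable ℝ c)
    {G : EuclideanSpace ℝ (Fin 3) → EuclideanSpace ℝ (Fin 3)} (hG : Differentiable ℝ G)
    (u : EuclideanSpace ℝ (Fin 3) → EuclideanSpace ℝ (Fin 3)) (y : EuclideanSpace ℝ (Fin 3)) :
    convect u (fun x => c (‖x‖ ^ 2) • cross x (G x)) y =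
      c (‖y‖ ^ 2) • (cross (u y) (G y) + cross y (fderiv ℝ G y (u y))) +
        (deriv c (‖y‖ ^ 2) * (2 * ⟪y, u y⟫)) • cross y (G y) := by
  have hcd : DifferentiableAt ℝ (fun x : EuclideanSpace ℝ (Fin 3) => c (‖x‖ ^ 2)) y :=
    (hc (‖y‖ ^ 2)).comp y ((hasStrictFDerivAt_norm_sq y).hasFDerivAt.differentiableAt)
  have hTd : DifferentiableAt ℝ (fun x => cross x (G x)) y :=
    ((contDiff_crossSelf_differentiable hG) y)
  rw [convect_apply, fderiv_fun_smul hcd hTd]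
  simp only [_root_.add_apply, _root_.smul_apply,
    ContinuousLinearMap.smulRight_apply, fderiv_crossSelf_apply (hG y), fderiv_radial_apply' hc]
  where
  /-- differentiability of the toroidalisation (local copy). [folklore] -/
  contDiff_crossSelf_differentiable {G : EuclideanSpace ℝ (Fin 3) → EuclideanSpace ℝ (Fin 3)}
      (hG : Differentiable ℝ G) : Differentiable ℝ fun x => cross x (G x) := by
    have e : (fun x => cross x (G x)) = fun x => crossCLM x (G x) := rfl
    rw [e]
    exact (crossCLM.differentiable.clm_apply hG)

/-- **Self-advection of a radially modulated toroidal lift**: the radial derivative drops out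
(`⟪y, y × G⟫ = 0`), `(T·∇)T(y) = c(‖y‖²)² · ((y × G) × G + y × DG(y)(y × G))` for
`T = c(‖·‖²) · (· × G)`. [folklore] -/
theorem convect_toroidal_self {c : ℝ → ℝ} (hc : Differentiable ℝ c)
    {G : EuclideanSpace ℝ (Fin 3) → EuclideanSpace ℝ (Fin 3)} (hG : Differentiable ℝ G)
    (y : EuclideanSpace ℝ (Fin 3)) :
    convect (fun x => c (‖x‖ ^ 2) • cross x (G x)) (fun x => c (‖x‖ ^ 2) • cross x (G x)) y =
      (c (‖y‖ ^ 2)) ^ 2 • (cross (cross y (G y)) (G y) + cross y (fderiv ℝ G y (cross y (G y)))) := by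
  rw [convect_toroidalLift hc hG]
  simp only [inner_smul_right, inner_self_cross', mul_zero, zero_smul, add_zero, map_smul,
    cross_smul_left', cross_smul_right', ← smul_add, smul_smul, pow_two]

/-! ## §2 The sectoral gradients and Hessians in coordinates (`ℓ(y) = y₀ + iy₁`) -/

section Coordinates

variable (hℓ : ∀ y : EuclideanSpace ℝ (Fin 3), ℓ y = ((y 0 : ℝ) : ℂ) + I * ((y 1 : ℝ) : ℂ))
include hℓ

/-- `ℓ(e₀) = 1`, `ℓ(e₁) = i`, `ℓ(e₂) = 0`. [folklore] -/
private theorem ell_single :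
    ℓ (EuclideanSpace.single 0 1) = 1 ∧ ℓ (EuclideanSpace.single 1 1) = I ∧
      ℓ (EuclideanSpace.single 2 1) = 0 := by
  refine ⟨?_, ?_, ?_⟩ <;> rw [hℓ] <;> simp

/-- **`∇Re ℓⁿ(y) = n·(Re ℓ(y)^{n−1}, −Im ℓ(y)^{n−1}, 0)`** — coordinate by coordinate. [folklore] -/
theorem gradient_re_pow_eq (n : ℕ) (y : EuclideanSpace ℝ (Fin 3)) :
    gradient (fun z => ((ℓ z) ^ n).re) y 0 = (n : ℝ) * ((ℓ y) ^ (n - 1)).re ∧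
      gradient (fun z => ((ℓ z) ^ n).re) y 1 = -((n : ℝ) * ((ℓ y) ^ (n - 1)).im) ∧
      gradient (fun z => ((ℓ z) ^ n).re) y 2 = 0 := by
  obtain ⟨h0, h1, h2⟩ := ell_single ℓ hℓ
  have hg : ∀ i : Fin 3, gradient (fun z => ((ℓ z) ^ n).re) y i =
      ((n : ℂ) * (ℓ y) ^ (n - 1) * ℓ (EuclideanSpace.single i 1)).re := fun i => by
    rw [apply_eq_inner_single, inner_gradient_left,
      fderiv_re_apply ((differentiable_clm_pow ℓ n) y), fderiv_clm_pow_apply]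
  refine ⟨?_, ?_, ?_⟩
  · rw [hg 0, h0, mul_one, re_ofNat_mul']
  · rw [hg 1, h1]; simp [mul_comm]
  · rw [hg 2, h2, mul_zero, zero_re]
  where
  /-- `Re (n * w) = n * Re w` for a natural number `n`. [folklore] -/
  re_ofNat_mul' {n : ℕ} {w : ℂ} : ((n : ℂ) * w).re = (n : ℝ) * w.re := by simp [Complex.mul_re]

/-- **`∇Im ℓⁿ(y) = n·(Im ℓ(y)^{n−1}, Re ℓ(y)^{n−1}, 0)`**. [folklore] -/
theorem gradient_im_pow_eq (n : ℕ) (y : EuclideanSpace ℝ (Fin 3)) :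
    gradient (fun z => ((ℓ z) ^ n).im) y 0 = (n : ℝ) * ((ℓ y) ^ (n - 1)).im ∧
      gradient (fun z => ((ℓ z) ^ n).im) y 1 = (n : ℝ) * ((ℓ y) ^ (n - 1)).re ∧
      gradient (fun z => ((ℓ z) ^ n).im) y 2 = 0 := by
  obtain ⟨h0, h1, h2⟩ := ell_single ℓ hℓ
  have hg : ∀ i : Fin 3, gradient (fun z => ((ℓ z) ^ n).im) y i =
      ((n : ℂ) * (ℓ y) ^ (n - 1) * ℓ (EuclideanSpace.single i 1)).im := fun i => by
    rw [apply_eq_inner_single, inner_gradient_left,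
      fderiv_im_apply ((differentiable_clm_pow ℓ n) y), fderiv_clm_pow_apply]
  refine ⟨?_, ?_, ?_⟩
  · rw [hg 0, h0, mul_one]; simp [Complex.mul_im]
  · rw [hg 1, h1]; simp [Complex.mul_im, Complex.mul_re]
  · rw [hg 2, h2, mul_zero, zero_im]

/-- **The Hessian of `Re ℓⁿ` in coordinates**: for every `v`,
`D(∇Re ℓⁿ)(y) v = (Re A, −Im A, 0)` with `A = n(n−1) ℓ(y)^{n−2} ℓ(v)`. [folklore] -/
theorem fderiv_gradient_re_pow_eq (n : ℕ) (y v : EuclideanSpace ℝ (Fin 3)) :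
    fderiv ℝ (gradient fun z => ((ℓ z) ^ n).re) y v 0 =
        ((n : ℂ) * ((n - 1 : ℕ) : ℂ) * (ℓ y) ^ (n - 1 - 1) * ℓ v).re ∧
      fderiv ℝ (gradient fun z => ((ℓ z) ^ n).re) y v 1 =
        -((n : ℂ) * ((n - 1 : ℕ) : ℂ) * (ℓ y) ^ (n - 1 - 1) * ℓ v).im ∧
      fderiv ℝ (gradient fun z => ((ℓ z) ^ n).re) y v 2 = 0 := by
  obtain ⟨h0, h1, h2⟩ := ell_single ℓ hℓ
  have hφ2 : ContDiff ℝ 2 (fun z => ((ℓ z) ^ n).re) := contDiff_infty.1 (contDiff_re_clm_pow ℓ n) 2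
  have hg : ∀ i : Fin 3, fderiv ℝ (gradient fun z => ((ℓ z) ^ n).re) y v i =
      ((n : ℂ) * ((n - 1 : ℕ) : ℂ) * (ℓ y) ^ (n - 1 - 1) * ℓ (EuclideanSpace.single i 1) * ℓ v).re :=
    fun i => by
      rw [apply_eq_inner_single, inner_fderiv_gradient hφ2, fderiv_fderiv_re_clm_pow,
        fderiv_fderiv_clm_pow]
  refine ⟨by rw [hg 0, h0, mul_one], ?_, by rw [hg 2, h2]; simp⟩
  rw [hg 1, h1, show (n : ℂ) * ((n - 1 : ℕ) : ℂ) * (ℓ y) ^ (n - 1 - 1) * I * ℓ v =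
    ((n : ℂ) * ((n - 1 : ℕ) : ℂ) * (ℓ y) ^ (n - 1 - 1) * ℓ v) * I by ring, Complex.mul_I_re]

/-- **The Hessian of `Im ℓⁿ` in coordinates**: `D(∇Im ℓⁿ)(y) v = (Im A, Re A, 0)`,
`A = n(n−1) ℓ(y)^{n−2} ℓ(v)`. [folklore] -/
theorem fderiv_gradient_im_pow_eq (n : ℕ) (y v : EuclideanSpace ℝ (Fin 3)) :
    fderiv ℝ (gradient fun z => ((ℓ z) ^ n).im) y v 0 =
        ((n : ℂ) * ((n - 1 : ℕ) : ℂ) * (ℓ y) ^ (n - 1 - 1) * ℓ v).im ∧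
      fderiv ℝ (gradient fun z => ((ℓ z) ^ n).im) y v 1 =
        ((n : ℂ) * ((n - 1 : ℕ) : ℂ) * (ℓ y) ^ (n - 1 - 1) * ℓ v).re ∧
      fderiv ℝ (gradient fun z => ((ℓ z) ^ n).im) y v 2 = 0 := by
  obtain ⟨h0, h1, h2⟩ := ell_single ℓ hℓ
  have hψ2 : ContDiff ℝ 2 (fun z => ((ℓ z) ^ n).im) := contDiff_infty.1 (contDiff_im_clm_pow ℓ n) 2
  have hg : ∀ i : Fin 3, fderiv ℝ (gradient fun z => ((ℓ z) ^ n).im) y v i =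
      ((n : ℂ) * ((n - 1 : ℕ) : ℂ) * (ℓ y) ^ (n - 1 - 1) * ℓ (EuclideanSpace.single i 1) * ℓ v).im :=
    fun i => by
      rw [apply_eq_inner_single, inner_fderiv_gradient hψ2, fderiv_fderiv_im_clm_pow,
        fderiv_fderiv_clm_pow]
  refine ⟨by rw [hg 0, h0, mul_one], ?_, by rw [hg 2, h2]; simp⟩
  rw [hg 1, h1, show (n : ℂ) * ((n - 1 : ℕ) : ℂ) * (ℓ y) ^ (n - 1 - 1) * I * ℓ v =
    ((n : ℂ) * ((n - 1 : ℕ) : ℂ) * (ℓ y) ^ (n - 1 - 1) * ℓ v) * I by ring, Complex.mul_I_im]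

/-! ## §3 The Reynolds stress of the sectoral toroidal wave in closed form -/

/-- **THE SECTORAL REYNOLDS STRESS.** For `n = m + 2 ≥ 2`, `ℓ(y) = y₀ + iy₁`, a differentiable
radial profile `c`, `W = c(‖·‖²)·(· × ∇Re ℓⁿ)` and its quadrature companion `W' = c(‖·‖²)·(· × ∇Im ℓⁿ)`:
`(W·∇)W(y) + (W'·∇)W'(y) = c(‖y‖²)² · (A·y₀, A·y₁, B)` with
`A = n²(2(n−1) y₂² s^{n−2} − s^{n−1})`, `B = −2n³ y₂ s^{n−1}`, `s = y₀² + y₁²` — a ZONAL, purely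
POLOIDAL (meridional) polynomial field: the wave's Reynolds stress forces rolls, not streaks.
[cite: BullardGellman1954] -/
theorem toroidalSectoral_selfAdvection_sum {c : ℝ → ℝ} (hc : Differentiable ℝ c) (m : ℕ)
    (y : EuclideanSpace ℝ (Fin 3)) :
    convect (fun x => c (‖x‖ ^ 2) • cross x (gradient (fun z => ((ℓ z) ^ (m + 2)).re) x))
        (fun x => c (‖x‖ ^ 2) • cross x (gradient (fun z => ((ℓ z) ^ (m + 2)).re) x)) y +
      convect (fun x => c (‖x‖ ^ 2) • cross x (gradient (fun z => ((ℓ z) ^ (m + 2)).im) x))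
        (fun x => c (‖x‖ ^ 2) • cross x (gradient (fun z => ((ℓ z) ^ (m + 2)).im) x)) y =
      (c (‖y‖ ^ 2)) ^ 2 • WithLp.toLp 2
        ![((m : ℝ) + 2) ^ 2 * (2 * ((m : ℝ) + 1) * (y 2) ^ 2 * ((y 0) ^ 2 + (y 1) ^ 2) ^ m -
              ((y 0) ^ 2 + (y 1) ^ 2) ^ (m + 1)) * y 0,
          ((m : ℝ) + 2) ^ 2 * (2 * ((m : ℝ) + 1) * (y 2) ^ 2 * ((y 0) ^ 2 + (y 1) ^ 2) ^ m -
              ((y 0) ^ 2 + (y 1) ^ 2) ^ (m + 1)) * y 1,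
          -(2 * ((m : ℝ) + 2) ^ 3 * y 2 * ((y 0) ^ 2 + (y 1) ^ 2) ^ (m + 1))] := by
  -- the two gradient fields are smooth
  have hGφ : Differentiable ℝ (gradient fun z => ((ℓ z) ^ (m + 2)).re) :=
    differentiable_gradient_of_smooth (contDiff_re_clm_pow ℓ (m + 2))
  have hGψ : Differentiable ℝ (gradient fun z => ((ℓ z) ^ (m + 2)).im) :=
    differentiable_gradient_of_smooth (contDiff_im_clm_pow ℓ (m + 2))
  rw [convect_toroidal_self hc hGφ, convect_toroidal_self hc hGψ, ← smul_add]
  congr 1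
  -- coordinates of the gradients
  obtain ⟨g0, g1, g2⟩ := gradient_re_pow_eq ℓ hℓ (m + 2) y
  obtain ⟨k0, k1, k2⟩ := gradient_im_pow_eq ℓ hℓ (m + 2) y
  simp only [show m + 2 - 1 = m + 1 by omega] at g0 g1 g2 k0 k1 k2
  -- the Hessians along the toroidal directions
  set Tφ : EuclideanSpace ℝ (Fin 3) := cross y (gradient (fun z => ((ℓ z) ^ (m + 2)).re) y) with hTφ
  set Tψ : EuclideanSpace ℝ (Fin 3) := cross y (gradient (fun z => ((ℓ z) ^ (m + 2)).im) y) with hTψ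
  obtain ⟨a0, a1, a2⟩ := fderiv_gradient_re_pow_eq ℓ hℓ (m + 2) y Tφ
  obtain ⟨b0, b1, b2⟩ := fderiv_gradient_im_pow_eq ℓ hℓ (m + 2) y Tψ
  simp only [show m + 2 - 1 = m + 1 by omega, show m + 1 - 1 = m by omega, Nat.cast_add,
    Nat.cast_one, Nat.cast_ofNat] at a0 a1 a2 b0 b1 b2 g0 g1 g2 k0 k1 k2
  -- coordinates of the toroidal vectors and their `ℓ`-values
  have t0 : Tφ 0 = y 2 * (((m : ℝ) + 2) * ((ℓ y) ^ (m + 1)).im) := by rw [hTφ, cross_apply_zero', g1, g2]; ring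
  have t1 : Tφ 1 = y 2 * (((m : ℝ) + 2) * ((ℓ y) ^ (m + 1)).re) := by rw [hTφ, cross_apply_one', g0, g2]; ring
  have t2 : Tφ 2 = -(y 0 * (((m : ℝ) + 2) * ((ℓ y) ^ (m + 1)).im)) -
      y 1 * (((m : ℝ) + 2) * ((ℓ y) ^ (m + 1)).re) := by
    rw [hTφ, cross_apply_two', g0, g1]; ring
  have u0 : Tψ 0 = -(y 2 * (((m : ℝ) + 2) * ((ℓ y) ^ (m + 1)).re)) := by rw [hTψ, cross_apply_zero', k1, k2]; ring
  have u1 : Tψ 1 = y 2 * (((m : ℝ) + 2) * ((ℓ y) ^ (m + 1)).im) := by rw [hTψ, cross_apply_one', k0, k2]; ring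
  have u2 : Tψ 2 = y 0 * (((m : ℝ) + 2) * ((ℓ y) ^ (m + 1)).re) -
      y 1 * (((m : ℝ) + 2) * ((ℓ y) ^ (m + 1)).im) := by
    rw [hTψ, cross_apply_two', k0, k1]
  have hℓT : ℓ Tφ = ((Tφ 0 : ℝ) : ℂ) + I * ((Tφ 1 : ℝ) : ℂ) := hℓ Tφ
  have hℓU : ℓ Tψ = ((Tψ 0 : ℝ) : ℂ) + I * ((Tψ 1 : ℝ) : ℂ) := hℓ Tψ
  -- real and imaginary parts of the Hessian scalars
  have hA : ∀ (M w : ℂ), (((m : ℂ) + 2) * ((m : ℂ) + 1) * M * w).re =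
      ((m : ℝ) + 2) * ((m : ℝ) + 1) * (M.re * w.re - M.im * w.im) := fun M w => by
    simp only [Complex.mul_re, Complex.mul_im, Complex.add_re, Complex.add_im,
      Complex.natCast_re, Complex.natCast_im, Complex.re_ofNat, Complex.im_ofNat,
      Complex.one_re, Complex.one_im]
    ring
  have hB : ∀ (M w : ℂ), (((m : ℂ) + 2) * ((m : ℂ) + 1) * M * w).im =
      ((m : ℝ) + 2) * ((m : ℝ) + 1) * (M.re * w.im + M.im * w.re) := fun M w => by
    simp only [Complex.mul_re, Complex.mul_im, Complex.add_re, Complex.add_im,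
      Complex.natCast_re, Complex.natCast_im, Complex.re_ofNat, Complex.im_ofNat,
      Complex.one_re, Complex.one_im]
    ring
  have hTre : (ℓ Tφ).re = Tφ 0 := by rw [hℓT]; simp
  have hTim : (ℓ Tφ).im = Tφ 1 := by rw [hℓT]; simp
  have hUre : (ℓ Tψ).re = Tψ 0 := by rw [hℓU]; simp
  have hUim : (ℓ Tψ).im = Tψ 1 := by rw [hℓU]; simp
  have a0' : fderiv ℝ (gradient fun z => ((ℓ z) ^ (m + 2)).re) y Tφ 0 =
      ((m : ℝ) + 2) * ((m : ℝ) + 1) * (((ℓ y) ^ m).re * Tφ 0 - ((ℓ y) ^ m).im * Tφ 1) := by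
    rw [a0, hA, hTre, hTim]
  have a1' : fderiv ℝ (gradient fun z => ((ℓ z) ^ (m + 2)).re) y Tφ 1 =
      -(((m : ℝ) + 2) * ((m : ℝ) + 1) * (((ℓ y) ^ m).re * Tφ 1 + ((ℓ y) ^ m).im * Tφ 0)) := by
    rw [a1, hB, hTre, hTim]
  have b0' : fderiv ℝ (gradient fun z => ((ℓ z) ^ (m + 2)).im) y Tψ 0 =
      ((m : ℝ) + 2) * ((m : ℝ) + 1) * (((ℓ y) ^ m).re * Tψ 1 + ((ℓ y) ^ m).im * Tψ 0) := by
    rw [b0, hB, hUre, hUim]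
  have b1' : fderiv ℝ (gradient fun z => ((ℓ z) ^ (m + 2)).im) y Tψ 1 =
      ((m : ℝ) + 2) * ((m : ℝ) + 1) * (((ℓ y) ^ m).re * Tψ 0 - ((ℓ y) ^ m).im * Tψ 1) := by
    rw [b1, hA, hUre, hUim]
  -- the powers: `ℓ^{m+1} = ℓ · ℓ^m`, `|ℓ^m|² = s^m`
  have hL : (ℓ y) ^ (m + 1) = ℓ y * (ℓ y) ^ m := by ring
  have hLre : ((ℓ y) ^ (m + 1)).re = y 0 * ((ℓ y) ^ m).re - y 1 * ((ℓ y) ^ m).im := by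
    rw [hL, Complex.mul_re, hℓ y]; simp
  have hLim : ((ℓ y) ^ (m + 1)).im = y 0 * ((ℓ y) ^ m).im + y 1 * ((ℓ y) ^ m).re := by
    rw [hL, Complex.mul_im, hℓ y]; simp
  have hs : ((y 0) ^ 2 + (y 1) ^ 2) ^ m = ((ℓ y) ^ m).re ^ 2 + ((ℓ y) ^ m).im ^ 2 := by
    have h1 : Complex.normSq ((ℓ y) ^ m) = ((y 0) ^ 2 + (y 1) ^ 2) ^ m := by
      rw [map_pow, hℓ y, Complex.normSq_apply]; simp; ring
    rw [← h1, Complex.normSq_apply]; ring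
  have hs1 : ((y 0) ^ 2 + (y 1) ^ 2) ^ (m + 1) =
      ((y 0) ^ 2 + (y 1) ^ 2) * (((ℓ y) ^ m).re ^ 2 + ((ℓ y) ^ m).im ^ 2) := by
    rw [pow_succ, hs]; ring
  -- assemble coordinate by coordinate (polynomial identities in y₀, y₁, y₂, Re ℓ^m, Im ℓ^m)
  rw [hs1, hs]
  apply PiLp.ext
  intro i
  fin_cases i <;>
    simp only [Fin.zero_eta, Fin.mk_one, Fin.reduceFinMk, Fin.isValue, PiLp.add_apply,
      cross_apply_zero', cross_apply_one', cross_apply_two',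
      Matrix.cons_val_zero, Matrix.cons_val_one, Matrix.cons_val_two, Matrix.head_cons,
      Matrix.tail_cons, g0, g1, g2, k0, k1, k2, a0', a1', a2, b0', b1', b2, t0, t1, t2, u0, u1,
      u2, hLre, hLim] <;>
    ring

/-! ## §4 In the line's letters: `J₃W = nW'`, so `meanStress n W = ½c²·(A y₀, A y₁, B)` -/

/-- `ℓ(e₃ × y) = iℓ(y)` for `ℓ(y) = y₀ + iy₁`. [folklore] -/
private theorem ell_cross_axis_two (y : EuclideanSpace ℝ (Fin 3)) :
    ℓ (crossCLM (axis 2) y) = I * ℓ y := by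
  rw [hℓ, hℓ, crossCLM_apply]
  apply Complex.ext <;> simp [cross, cross_apply, axis]

/-- **The quadrature companion of the sectoral toroidal wave**: `J₃(c(‖·‖²)·(· × ∇Re ℓⁿ)) =
n · c(‖·‖²)·(· × ∇Im ℓⁿ)` — the letter `waveConj n W = n⁻¹J₃W` of the line is the toroidal
wave of `Im ℓⁿ` (tree `angGen_radial_smul`, `angGen_crossSelf`, `angGen_two_gradient_re`).
[folklore] -/
theorem angGen_two_toroidalSectoral {c : ℝ → ℝ} (hc : Differentiable ℝ c) (n : ℕ)
    (y : EuclideanSpace ℝ (Fin 3)) :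
    angGen 2 (fun x => c (‖x‖ ^ 2) • cross x (gradient (fun z => ((ℓ z) ^ n).re) x)) y =
      (n : ℝ) • (c (‖y‖ ^ 2) • cross y (gradient (fun z => ((ℓ z) ^ n).im) y)) := by
  have hG : Differentiable ℝ (gradient fun z => ((ℓ z) ^ n).re) :=
    differentiable_gradient_of_smooth (contDiff_re_clm_pow ℓ n)
  have hT : Differentiable ℝ (fun x => cross x (gradient (fun z => ((ℓ z) ^ n).re) x)) :=
    convect_toroidalLift.contDiff_crossSelf_differentiable hG
  rw [angGen_radial_smul hc hT, angGen_crossSelf hG, angGen_two_gradient_re ℓ (ell_cross_axis_two ℓ hℓ) n]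
  simp only [cross_smul_right', smul_smul, mul_comm]

/-- **THE MEAN REYNOLDS STRESS OF THE SECTORAL TOROIDAL WAVE, in the letters of the line**
(`meanStress n W = ½((W·∇)W + (W'·∇)W')`, `W' = waveConj n W = n⁻¹·J₃W`): for `n = m + 2`,
`meanStress n W (y) = ½ c(‖y‖²)² · (A y₀, A y₁, B)` with `A = n²(2(n−1)y₂² s^{n−2} − s^{n−1})`,
`B = −2n³ y₂ s^{n−1}`, `s = y₀² + y₁²`. [cite: BullardGellman1954] -/
theorem meanStress_toroidalSectoral {c : ℝ → ℝ} (hc : Differentiable ℝ c) (m : ℕ)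
    (y : EuclideanSpace ℝ (Fin 3)) :
    (1 / 2 : ℝ) • (convect (fun x => c (‖x‖ ^ 2) • cross x (gradient (fun z => ((ℓ z) ^ (m + 2)).re) x))
        (fun x => c (‖x‖ ^ 2) • cross x (gradient (fun z => ((ℓ z) ^ (m + 2)).re) x)) y +
      convect (fun x => ((m + 2 : ℕ) : ℝ)⁻¹ •
          angGen 2 (fun x => c (‖x‖ ^ 2) • cross x (gradient (fun z => ((ℓ z) ^ (m + 2)).re) x)) x)
        (fun x => ((m + 2 : ℕ) : ℝ)⁻¹ •
          angGen 2 (fun x => c (‖x‖ ^ 2) • cross x (gradient (fun z => ((ℓ z) ^ (m + 2)).re) x)) x)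
        y) =
      ((1 / 2 : ℝ) * (c (‖y‖ ^ 2)) ^ 2) • WithLp.toLp 2
        ![((m : ℝ) + 2) ^ 2 * (2 * ((m : ℝ) + 1) * (y 2) ^ 2 * ((y 0) ^ 2 + (y 1) ^ 2) ^ m -
              ((y 0) ^ 2 + (y 1) ^ 2) ^ (m + 1)) * y 0,
          ((m : ℝ) + 2) ^ 2 * (2 * ((m : ℝ) + 1) * (y 2) ^ 2 * ((y 0) ^ 2 + (y 1) ^ 2) ^ m -
              ((y 0) ^ 2 + (y 1) ^ 2) ^ (m + 1)) * y 1,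
          -(2 * ((m : ℝ) + 2) ^ 3 * y 2 * ((y 0) ^ 2 + (y 1) ^ 2) ^ (m + 1))] := by
  have hconj : (fun x => ((m + 2 : ℕ) : ℝ)⁻¹ •
      angGen 2 (fun x => c (‖x‖ ^ 2) • cross x (gradient (fun z => ((ℓ z) ^ (m + 2)).re) x)) x) =
      fun x => c (‖x‖ ^ 2) • cross x (gradient (fun z => ((ℓ z) ^ (m + 2)).im) x) := by
    funext x
    rw [angGen_two_toroidalSectoral ℓ hℓ hc (m + 2) x, smul_smul,
      inv_mul_cancel₀ (by positivity), one_smul]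
  rw [hconj, toroidalSectoral_selfAdvection_sum ℓ hℓ hc m y, smul_smul]

end Coordinates

end Summit.NavierStokesRegularity.AngularGalerkinLadderSectoralReynoldsStress

end
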